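import Summits.QuantumFields.YangMills.Theorems.BalabanUVNodesN15ColouredDirichletCovarianceDecay
import HarnessLib

/-!
# N15 = NE2 — PROGRAMME Ð (Ð-3): ★★ THE η-RATE OF THE COLOURED (2.156) COVARIANCE WITH DIRICHLET ELIMINATION — King's (4.38) shape `C′((n₁)⁻¹ + τ)e^{−δ′·cdist}`, ONE `(C′, δ′)` FOR EVERY REGION
# (dag-n15-a g30, programme Ð «Dirichlet», FILE (Ð-3); node N15 = NE2; `--supports stmt-QuantumFields-27366 --as helper`, count-neutral; theorems only, 0 def)

WHY ∕ HOW.  The UNIT layer of NE2 with a genuine Dirichlet region wants the η-DIFFERENCE of the (2.156) covariance `C^{(k)}_Λ` between the fine and the coarse run, uniformly in Λ.  (Ð-2)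
`covCS_decay` gives the two endpoint decays (and invertibility) for every sub-family `S`; the resolvent identity and King's (4.41) triple-decay bound are `T4Cov2156Rate.redCov_rate` — GENERIC in
the elimination matrix, so it applies to `elimCS L M ι S hS` verbatim; the middle letter is `(Δ^{(n₂)} − Δ^{(n₁)})⊗1 + (P₂ − P₁)` ((G) `kernelRate166_col` + `τ`); the row sums are (G) `colSum_le`.
(L-3)'s proof, with the region threaded through.

WHAT.  ★★ `covCS_rate (hd) (hL) (N_c) (hδP) : ∃ C′ δ′ > 0, ∀ M (L ∣ M) S hS ι (|ι| ≤ N_c) n₁ n₂ R (1 ≤ n₁, 1 ≤ R, n₂ = R·n₁) P₁ P₂ ε τ (…letters…), ∀ p q,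
|covCS S (Δ^{(n₂)}⊗1 + P₂) p q − covCS S (Δ^{(n₁)}⊗1 + P₁) p q| ≤ C′((n₁ : ℝ)⁻¹ + τ)e^{−δ′·cdist p q}`; ★★ `covCS_rate_king` (`n₁ = L^k`, `n₂ = L^m·L^k`).
Honest label: bookkeeping over landed rows; NO layer of NE2 proved here; no count. [cite: King1986, Lemma 4.5 (4.38)–(4.41) pp.674–675 (shape, mechanism); Balaban1984PropagatorsII, (2.156) p.250 (object); Balaban1985BackgroundPropagators, §E p.427, Thm 3.15 (3.187) p.432 (shape, uniformity in Λ)]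
-/

noncomputable section

open scoped BigOperators Matrix Kronecker

namespace Summit.QuantumFields.YangMills.BalabanUVNodes.N15.UnitLayerBgCol

open Literature.MathematicalPhysics.QuantumFieldTheory.Balaban1983to89
open Literature.MathematicalPhysics.QuantumFieldTheory.King1986 (exp_decay_mono)
open Literature.MathematicalPhysics.QuantumFieldTheory.Balaban1983to89.B5Prop11Plancherel (Tor fine)
open Literature.MathematicalPhysics.QuantumFieldTheory.Balaban1983to89.B6Lemma24Torus (pbox)
open Literature.MathematicalPhysics.QuantumFieldTheory.Balaban1983to89.B6Cov2156Torus (freeT elimT deltaPol one_le_M)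
open Literature.MathematicalPhysics.QuantumFieldTheory.Balaban1983to89.T4Cov2156Rate (redCov redCov_rate)
open Literature.MathematicalPhysics.QuantumFieldTheory.Balaban1983to89.B4Sect5Proof (latticeConst latticeConst_nonneg)

variable {d : ℕ} (L : ℕ)

/-- ★★ **THE η-RATE OF THE COLOURED (2.156) COVARIANCE WITH DIRICHLET ELIMINATION, UNIFORM IN THE REGION** — (L-3) `covC_rate` on the kept variables of ANY sub-family `S` (the Λ-bonds of any
Dirichlet region `Λ = B(Λ′₀)`): for `d ≥ 1`, `L ≥ 1`, `δ_P > 0`, `N_c` there are `C′, δ′ > 0` (after `d, L, δ_P, N_c` ONLY) with `|covCS(Δ^{(n₂)}⊗1 + P₂)(p,q) − covCS(Δ^{(n₁)}⊗1 + P₁)(p,q)| ≤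
C′·(n₁⁻¹ + τ)·e^{−δ′·cdist(p,q)}` for every torus (`L ∣ M`), every `S`, colour type (`|ι| ≤ N_c`), levels `n₂ = R·n₁`, admissible `P₁, P₂` (`|P_i| ≤ εe^{−δ_P cdist}`, `ε ≤ epsCovC`) and any letter
`|P₂ − P₁| ≤ τe^{−δ_P cdist}` (`redCov_rate` — generic in the elimination matrix — with both endpoint decays from (Ð-2) `covCS_decay`, middle factor `kernelRate166_col + τ`).
[cite: King1986, Lemma 4.5 (4.38)–(4.41) pp.674–675 (mechanism); Balaban1984PropagatorsII, (2.156) p.250 (object); Balaban1985BackgroundPropagators, §E p.427, Thm 3.15 (3.187) p.432 (uniformity in Λ)] -/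
theorem covCS_rate (hd : 1 ≤ d) (hL : 1 ≤ L) (Nc : ℕ) {δP : ℝ} (hδP : 0 < δP) :
    ∃ C' δ' : ℝ, 0 < C' ∧ 0 < δ' ∧
      ∀ (M : Fin (d + 1) → ℕ) [∀ μ, NeZero (M μ)], (∀ μ, L ∣ M μ) → ∀ (S : Finset (B4.Idx (pbox M) (d + 1))) (hS : S ⊆ freeT L M),
      ∀ (ι : Type) [Fintype ι] [DecidableEq ι], Fintype.card ι ≤ Nc → ∀ (n₁ n₂ R : ℕ), 1 ≤ n₁ → 1 ≤ R → n₂ = R * n₁ →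
        ∀ (P₁ P₂ : Matrix (B4.Idx (pbox M) (d + 1) × ι) (B4.Idx (pbox M) (d + 1) × ι) ℝ) (ε τ : ℝ), 0 ≤ ε → ε ≤ epsCovC d L Nc δP → 0 ≤ τ →
        (∀ p q, |P₁ p q| ≤ ε * Real.exp (-(δP * cdist M ι p q))) →
        (∀ p q, |P₂ p q| ≤ ε * Real.exp (-(δP * cdist M ι p q))) →
        (∀ p q, |P₂ p q - P₁ p q| ≤ τ * Real.exp (-(δP * cdist M ι p q))) →
        ∀ p q, |covCS L M ι S hS (deltaPol M n₂ ⊗ₖ (1 : Matrix ι ι ℝ) + P₂) p q - covCS L M ι S hS (deltaPol M n₁ ⊗ₖ (1 : Matrix ι ι ℝ) + P₁) p q|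
          ≤ C' * ((n₁ : ℝ)⁻¹ + τ) * Real.exp (-(δ' * cdist M ι p q)) := by
  obtain ⟨θ₀, δ₁, hθ₀, hδ₁, hR⟩ := kernelRate166_col d (by omega)
  obtain ⟨c, δ, hc, hδ, hD⟩ := covCS_decay d L hd hL Nc hδP
  set κ := min (min δ δ₁) δP with hκdef
  have hκ : 0 < κ := lt_min (lt_min hδ hδ₁) hδP
  have hκδ : κ ≤ δ := (min_le_left _ _).trans (min_le_left _ _)
  have hκδ₁ : κ ≤ δ₁ := (min_le_left _ _).trans (min_le_right _ _)
  have hκP : κ ≤ δP := min_le_right _ _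
  have hd0 : (0 : ℝ) < (d : ℝ) + 1 := by positivity
  set V := (Nc : ℝ) * (((d : ℝ) + 1) * latticeConst (d + 1) (κ / 2)) with hV
  have hV0 : 0 ≤ V := by have := latticeConst_nonneg (d + 1) (half_pos hκ).le; positivity
  refine ⟨c * (θ₀ + 1) * c * V ^ 2 + 1, κ / 2, by positivity, by positivity, ?_⟩
  intro M _ hLM S hS ι _ _ hι n₁ n₂ R' hn₁ hR1 h P₁ P₂ ε τ hε hεe hτ hP₁ hP₂ hP21 p q
  have hn₂ : 1 ≤ n₂ := by subst h; exact Nat.one_le_iff_ne_zero.mpr (Nat.mul_ne_zero (by omega) (by omega))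
  have hιr : (Fintype.card ι : ℝ) ≤ Nc := by exact_mod_cast hι
  -- the two endpoints (L-2): invertibility + decay at rate κ
  obtain ⟨hU₁, hC₁⟩ := hD M hLM S hS ι hι n₁ hn₁ P₁ ε hε hεe hP₁
  obtain ⟨hU₂, hC₂⟩ := hD M hLM S hS ι hι n₂ hn₂ P₂ ε hε hεe hP₂
  have hC₁' : ∀ x y, |redCov (elimCS L M ι S hS) (deltaPol M n₁ ⊗ₖ (1 : Matrix ι ι ℝ) + P₁) x y| ≤ c * Real.exp (-(κ * cdist M ι x y)) :=
    fun x y => (hC₁ x y).trans (exp_decay_mono hc.le hκδ (cdist_nonneg M ι x y))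
  have hC₂' : ∀ x y, |redCov (elimCS L M ι S hS) (deltaPol M n₂ ⊗ₖ (1 : Matrix ι ι ℝ) + P₂) x y| ≤ c * Real.exp (-(κ * cdist M ι x y)) :=
    fun x y => (hC₂ x y).trans (exp_decay_mono hc.le hκδ (cdist_nonneg M ι x y))
  -- the middle factor: `(Δ₂⊗1 + P₂) − (Δ₁⊗1 + P₁) = (Δ₂ − Δ₁)⊗1 + (P₂ − P₁)`
  have hθn : 0 ≤ θ₀ * (n₁ : ℝ)⁻¹ + τ := add_nonneg (mul_nonneg hθ₀.le (inv_nonneg.mpr (Nat.cast_nonneg _))) hτ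
  have hE : ∀ z w, |(deltaPol M n₂ ⊗ₖ (1 : Matrix ι ι ℝ) + P₂ - (deltaPol M n₁ ⊗ₖ (1 : Matrix ι ι ℝ) + P₁)) z w| ≤ (θ₀ * (n₁ : ℝ)⁻¹ + τ) * Real.exp (-(κ * cdist M ι z w)) := by
    intro z w
    have e : (deltaPol M n₂ ⊗ₖ (1 : Matrix ι ι ℝ) + P₂ - (deltaPol M n₁ ⊗ₖ (1 : Matrix ι ι ℝ) + P₁)) z w =
        ((deltaPol M n₂ ⊗ₖ (1 : Matrix ι ι ℝ)) z w - (deltaPol M n₁ ⊗ₖ (1 : Matrix ι ι ℝ)) z w) + (P₂ z w - P₁ z w) := by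
      simp only [Matrix.sub_apply, Matrix.add_apply]; ring
    rw [e]
    have h1 := (hR M ι n₁ n₂ R' hn₁ hR1 h z w).trans (exp_decay_mono (mul_nonneg hθ₀.le (inv_nonneg.mpr (Nat.cast_nonneg _))) hκδ₁ (cdist_nonneg M ι z w))
    have h2 := (hP21 z w).trans (exp_decay_mono hτ hκP (cdist_nonneg M ι z w))
    calc |(deltaPol M n₂ ⊗ₖ (1 : Matrix ι ι ℝ)) z w - (deltaPol M n₁ ⊗ₖ (1 : Matrix ι ι ℝ)) z w + (P₂ z w - P₁ z w)|
        ≤ |(deltaPol M n₂ ⊗ₖ (1 : Matrix ι ι ℝ)) z w - (deltaPol M n₁ ⊗ₖ (1 : Matrix ι ι ℝ)) z w| + |P₂ z w - P₁ z w| := abs_add_le _ _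
      _ ≤ θ₀ * (n₁ : ℝ)⁻¹ * Real.exp (-(κ * cdist M ι z w)) + τ * Real.exp (-(κ * cdist M ι z w)) := add_le_add h1 h2
      _ = (θ₀ * (n₁ : ℝ)⁻¹ + τ) * Real.exp (-(κ * cdist M ι z w)) := by ring
  have hVb : ∀ x, ∑ z, Real.exp (-(κ / 2 * cdist M ι x z)) ≤ V := fun x =>
    (colSum_le M ι (half_pos hκ) x).trans (mul_le_mul_of_nonneg_right hιr (mul_nonneg hd0.le (latticeConst_nonneg (d + 1) (half_pos hκ).le)))
  have main := redCov_rate (cdist M ι) (cdist_nonneg M ι) (cdist_triangle M ι) (elimCS L M ι S hS) (deltaPol M n₁ ⊗ₖ (1 : Matrix ι ι ℝ) + P₁) (deltaPol M n₂ ⊗ₖ (1 : Matrix ι ι ℝ) + P₂)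
    hU₁ hU₂ hκ.le hc.le hθn hC₁' hC₂' hE hVb p q
  show |redCov (elimCS L M ι S hS) (deltaPol M n₂ ⊗ₖ (1 : Matrix ι ι ℝ) + P₂) p q - redCov (elimCS L M ι S hS) (deltaPol M n₁ ⊗ₖ (1 : Matrix ι ι ℝ) + P₁) p q| ≤ _
  rw [abs_sub_comm]
  refine main.trans ?_
  have hEx := Real.exp_nonneg (-(κ / 2 * cdist M ι p q))
  have hn0 : 0 ≤ (n₁ : ℝ)⁻¹ := inv_nonneg.mpr (Nat.cast_nonneg _)
  have hmid : θ₀ * (n₁ : ℝ)⁻¹ + τ ≤ (θ₀ + 1) * ((n₁ : ℝ)⁻¹ + τ) := by nlinarith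
  calc c * (θ₀ * (n₁ : ℝ)⁻¹ + τ) * c * V ^ 2 * Real.exp (-(κ / 2 * cdist M ι p q))
      ≤ c * ((θ₀ + 1) * ((n₁ : ℝ)⁻¹ + τ)) * c * V ^ 2 * Real.exp (-(κ / 2 * cdist M ι p q)) := by gcongr
    _ = (c * (θ₀ + 1) * c * V ^ 2) * ((n₁ : ℝ)⁻¹ + τ) * Real.exp (-(κ / 2 * cdist M ι p q)) := by ring
    _ ≤ (c * (θ₀ + 1) * c * V ^ 2 + 1) * ((n₁ : ℝ)⁻¹ + τ) * Real.exp (-(κ / 2 * cdist M ι p q)) :=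
        mul_le_mul_of_nonneg_right (mul_le_mul_of_nonneg_right (by linarith) (add_nonneg hn0 hτ)) hEx

/-- ★★ **KING's (4.38) SHAPE FOR THE COLOURED PERTURBED DIRICHLET COVARIANCE**: `n₁ = L^k`, `n₂ = L^m·L^k`: `|covCS(Δ^{(L^mL^k)}⊗1 + P₂) − covCS(Δ^{(L^k)}⊗1 + P₁)|(p,q) ≤ C′·((L^k)⁻¹ + τ)·e^{−δ′·cdist}`,
uniformly in `k, m`, the torus, THE REGION, the colour type and the admissible perturbations. [cite: King1986, Lemma 4.5 (4.38) p.674 (shape); Balaban1984PropagatorsII, (2.156) p.250 (object); Balaban1985BackgroundPropagators, Thm 3.15 (3.187) p.432] -/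
theorem covCS_rate_king (hd : 1 ≤ d) (hL : 1 ≤ L) (Nc : ℕ) {δP : ℝ} (hδP : 0 < δP) :
    ∃ C' δ' : ℝ, 0 < C' ∧ 0 < δ' ∧
      ∀ (M : Fin (d + 1) → ℕ) [∀ μ, NeZero (M μ)], (∀ μ, L ∣ M μ) → ∀ (S : Finset (B4.Idx (pbox M) (d + 1))) (hS : S ⊆ freeT L M),
      ∀ (ι : Type) [Fintype ι] [DecidableEq ι], Fintype.card ι ≤ Nc → ∀ (k m : ℕ),
        ∀ (P₁ P₂ : Matrix (B4.Idx (pbox M) (d + 1) × ι) (B4.Idx (pbox M) (d + 1) × ι) ℝ) (ε τ : ℝ), 0 ≤ ε → ε ≤ epsCovC d L Nc δP → 0 ≤ τ →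
        (∀ p q, |P₁ p q| ≤ ε * Real.exp (-(δP * cdist M ι p q))) →
        (∀ p q, |P₂ p q| ≤ ε * Real.exp (-(δP * cdist M ι p q))) →
        (∀ p q, |P₂ p q - P₁ p q| ≤ τ * Real.exp (-(δP * cdist M ι p q))) →
        ∀ p q, |covCS L M ι S hS (deltaPol M (L ^ m * L ^ k) ⊗ₖ (1 : Matrix ι ι ℝ) + P₂) p q - covCS L M ι S hS (deltaPol M (L ^ k) ⊗ₖ (1 : Matrix ι ι ℝ) + P₁) p q|
          ≤ C' * (((L : ℝ) ^ k)⁻¹ + τ) * Real.exp (-(δ' * cdist M ι p q)) := by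
  obtain ⟨C', δ', hC', hδ', H⟩ := covCS_rate L hd hL Nc hδP
  refine ⟨C', δ', hC', hδ', fun M _ hLM S hS ι _ _ hι k m P₁ P₂ ε τ hε hεe hτ hP₁ hP₂ hP21 p q => ?_⟩
  have hLk : 1 ≤ L ^ k := Nat.one_le_pow _ _ hL
  have hLm : 1 ≤ L ^ m := Nat.one_le_pow _ _ hL
  have h := H M hLM S hS ι hι (L ^ k) (L ^ m * L ^ k) (L ^ m) hLk hLm rfl P₁ P₂ ε τ hε hεe hτ hP₁ hP₂ hP21 p q
  simpa using h

end Summit.QuantumFields.YangMills.BalabanUVNodes.N15.UnitLayerBgCol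

end
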